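import Summits.AtomisticToContinuum.Crystallization.Theorems.ThreeConeCertificateSlackRigidityPricedFloorsS3Defs2
import HarnessLib

/-!
# `SlackRigidity` (stmt-AtomisticToContinuum-11960), line `priced-floors-palm-exactification`, stub S3
# (`stub_layeredMeanSelection`): evaluating the transported integrals (counting-measure bookkeeping)

Lead c19, S3 part 5 (deterministic).  For a countable sample `S` and a SENT WEIGHT of the form
`w(y) = (1/(2n+1)) Σ_{|m| ≤ n} 1[y ∈ T m]/#(T m)` (uniform over the `2n+1` layers around the root,
uniform over the finitely many nonempty, pairwise disjoint target sets `T m ⊆ S`), the transported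
integral of a nonnegative function `g` that is constant `= c m` on each `T m` is
`∫⁻ ofReal(w y) · ofReal(g y) d(count|S) = ofReal((1/(2n+1)) Σ_{|m| ≤ n} c m)` (`lms_lintegral_avg_eq`,
registered), and is `≥ ofReal(b)` as soon as `Σ_{|m| ≤ n} c m ≥ (2n+1) b` (`lintegral_avg_ge`).  Also the
resummation `1[y = 0] + 2 Σ_{k=1}^{n} transportWeight k e y = Σ_{|m| ≤ n} 1[y ∈ T m]/#(T m)` for
`T = layerTargets e` with `T 0 = {0}` (`transportWeight_resum`).  All `[folklore]`.
-/

noncomputable section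

open MeasureTheory Filter Set
open scoped ENNReal BigOperators Topology

namespace Summit.AtomisticToContinuum.Crystallization.Theorems.SlackRigidityPricedFloorsIdent

open Summit.AtomisticToContinuum.Crystallization.Theorems.SlackRigidityPricedFloors

/-- Symmetric integer window as `{0} ∪ {k, −k : 1 ≤ k ≤ n}`: resummation of a function. [folklore] -/
theorem sum_Icc_neg_eq (f : ℤ → ℝ) (n : ℕ) :
    ∑ m ∈ Finset.Icc (-(n : ℤ)) n, f m = f 0 + ∑ k ∈ Finset.Icc 1 n, (f k + f (-(k : ℤ))) := by
  induction n with
  | zero => simp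
  | succ n ih =>
    rw [Finset.sum_Icc_succ_top (by norm_num : 1 ≤ n + 1), ← add_assoc, ← ih]
    have h1 : Finset.Icc (-((n + 1 : ℕ) : ℤ)) ((n + 1 : ℕ) : ℤ) =
        insert (-((n + 1 : ℕ) : ℤ)) (insert ((n + 1 : ℕ) : ℤ) (Finset.Icc (-(n : ℤ)) n)) := by
      ext m
      simp only [Finset.mem_Icc, Finset.mem_insert]
      push_cast
      omega
    rw [h1, Finset.sum_insert, Finset.sum_insert]
    · push_cast; ring
    · simp only [Finset.mem_Icc]; push_cast; omega
    · simp only [Finset.mem_insert, Finset.mem_Icc]; push_cast; omega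

/-- **Resummation of the averaged transport weight**: with `T = layerTargets e` and `T 0 = {0}`,
`1[y = 0] + 2 Σ_{k=1}^{n} transportWeight k e y = Σ_{|m| ≤ n} 1[y ∈ T m]/#(T m)`. [folklore] -/
theorem transportWeight_resum (e : LData) (h0 : layerTargets e 0 = {0}) (n : ℕ) (y : E3) :
    (if y = 0 then (1 : ℝ) else 0) + 2 * ∑ k ∈ Finset.Icc 1 n, transportWeight k e y =
      ∑ m ∈ Finset.Icc (-(n : ℤ)) n,
        (if y ∈ layerTargets e m then (1 : ℝ) / (layerTargets e m).card else 0) := by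
  rw [sum_Icc_neg_eq, h0, Finset.mul_sum]
  congr 1
  · simp
  · refine Finset.sum_congr rfl fun k _ => ?_
    simp only [transportWeight]
    ring

variable {S : Set E3}

/-- **The transported integral of a layerwise constant function** (registered sub-goal
`lms_lintegral_avg_eq`). [folklore] -/
theorem lms_lintegral_avg_eq : ∀ (S : Set E3), S.Countable → ∀ (T : ℤ → Finset E3), (∀ m, (↑(T m) : Set E3) ⊆ S) → (∀ m, (T m).Nonempty) → (∀ m m', m ≠ m' → Disjoint (T m) (T m')) → ∀ (n : ℕ) (w g : E3 → ℝ) (c : ℤ → ℝ), (∀ y, w y = (1 / (2 * n + 1)) * ∑ m ∈ Finset.Icc (-(n : ℤ)) n, (if y ∈ T m then (1 : ℝ) / (T m).card else 0)) → (∀ y, 0 ≤ g y) → (∀ m, ∀ y ∈ T m, g y = c m) → ∫⁻ y, ENNReal.ofReal (w y) * ENNReal.ofReal (g y) ∂((Measure.count : Measure E3).restrict S) = ENNReal.ofReal ((1 / (2 * n + 1)) * ∑ m ∈ Finset.Icc (-(n : ℤ)) n, c m) := by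
  intro S hS T hTS hTne hTd n w g c hw hg hgc
  -- the support: `F = ⋃_{|m| ≤ n} T m`, a finite subset of `S`
  set F : Finset E3 := (Finset.Icc (-(n : ℤ)) n).biUnion T with hF
  have hFS : (↑F : Set E3) ⊆ S := by
    intro y hy
    simp only [hF, Finset.coe_biUnion, Finset.mem_coe, mem_iUnion, exists_prop] at hy
    obtain ⟨m, -, hm⟩ := hy
    exact hTS m hm
  have hw0 : ∀ y, y ∉ F → w y = 0 := by
    intro y hy
    rw [hw y]
    refine mul_eq_zero_of_right _ (Finset.sum_eq_zero fun m hm => ?_)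
    rw [if_neg]
    intro h
    exact hy (Finset.mem_biUnion.2 ⟨m, hm, h⟩)
  have hwnn : ∀ y, 0 ≤ w y := by
    intro y; rw [hw y]
    refine mul_nonneg (by positivity) (Finset.sum_nonneg fun m _ => ?_)
    split_ifs <;> positivity
  -- reduce the integral over `count|S` to a finite sum over `F`
  have hSm : MeasurableSet S := hS.measurableSet
  have h1 : ∫⁻ y, ENNReal.ofReal (w y) * ENNReal.ofReal (g y) ∂((Measure.count : Measure E3).restrict S) =
      ∑ y ∈ F, ENNReal.ofReal (w y * g y) := by
    rw [← union_sdiff_cancel hFS, lintegral_union (hSm.diff F.measurableSet) disjoint_sdiff_right,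
      lintegral_finset]
    have h0 : ∫⁻ y in S \ ↑F, ENNReal.ofReal (w y) * ENNReal.ofReal (g y) ∂(Measure.count : Measure E3) = 0 := by
      rw [setLIntegral_congr_fun (hSm.diff F.measurableSet)
        (g := fun _ => 0) (fun y hy => by rw [hw0 y hy.2, ENNReal.ofReal_zero, zero_mul])]
      simp
    rw [h0, add_zero]
    refine Finset.sum_congr rfl fun y _ => ?_
    rw [Measure.count_singleton, mul_one, ENNReal.ofReal_mul (hwnn y)]
  rw [h1, ← ENNReal.ofReal_sum_of_nonneg (fun y _ => mul_nonneg (hwnn y) (hg y))]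
  congr 1
  -- evaluate the finite sum
  have h2 : ∀ m ∈ Finset.Icc (-(n : ℤ)) n,
      ∑ y ∈ F, (if y ∈ T m then (1 : ℝ) / (T m).card else 0) * g y = c m := by
    intro m hm
    have hsub : T m ⊆ F := Finset.subset_biUnion_of_mem T hm
    rw [← Finset.sum_subset hsub (fun y _ hy => by rw [if_neg hy, zero_mul])]
    rw [Finset.sum_congr rfl (g := fun _ => (1 : ℝ) / (T m).card * c m)
      (fun y hy => by rw [if_pos hy, hgc m y hy])]
    rw [Finset.sum_const, nsmul_eq_mul]
    have : ((T m).card : ℝ) ≠ 0 := Nat.cast_ne_zero.2 (Finset.card_pos.2 (hTne m)).ne'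
    field_simp
  calc ∑ y ∈ F, w y * g y
      = ∑ y ∈ F, (1 / (2 * n + 1)) * ∑ m ∈ Finset.Icc (-(n : ℤ)) n,
          (if y ∈ T m then (1 : ℝ) / (T m).card else 0) * g y := by
        refine Finset.sum_congr rfl fun y _ => ?_
        rw [hw y, mul_assoc, Finset.sum_mul]
    _ = (1 / (2 * n + 1)) * ∑ m ∈ Finset.Icc (-(n : ℤ)) n,
          ∑ y ∈ F, (if y ∈ T m then (1 : ℝ) / (T m).card else 0) * g y := by
        rw [← Finset.mul_sum, Finset.sum_comm]
    _ = (1 / (2 * n + 1)) * ∑ m ∈ Finset.Icc (-(n : ℤ)) n, c m := by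
        rw [Finset.sum_congr rfl h2]

/-- **Lower bound form**: if moreover `Σ_{|m| ≤ n} c m ≥ (2n+1) b`, the transported integral is at
least `ofReal b`. [folklore] -/
theorem lintegral_avg_ge (hS : S.Countable) (T : ℤ → Finset E3) (hTS : ∀ m, (↑(T m) : Set E3) ⊆ S)
    (hTne : ∀ m, (T m).Nonempty) (hTd : ∀ m m', m ≠ m' → Disjoint (T m) (T m')) (n : ℕ)
    (w g : E3 → ℝ) (c : ℤ → ℝ)
    (hw : ∀ y, w y = (1 / (2 * n + 1)) * ∑ m ∈ Finset.Icc (-(n : ℤ)) n,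
      (if y ∈ T m then (1 : ℝ) / (T m).card else 0))
    (hg : ∀ y, 0 ≤ g y) (hgc : ∀ m, ∀ y ∈ T m, g y = c m) {b : ℝ}
    (hb : (2 * n + 1) * b ≤ ∑ m ∈ Finset.Icc (-(n : ℤ)) n, c m) :
    ENNReal.ofReal b ≤
      ∫⁻ y, ENNReal.ofReal (w y) * ENNReal.ofReal (g y) ∂((Measure.count : Measure E3).restrict S) := by
  rw [lms_lintegral_avg_eq S hS T hTS hTne hTd n w g c hw hg hgc]
  refine ENNReal.ofReal_le_ofReal ?_
  have hpos : (0 : ℝ) < 2 * n + 1 := by positivity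
  rw [one_div_mul_eq_div, le_div_iff₀ hpos]
  linarith

end Summit.AtomisticToContinuum.Crystallization.Theorems.SlackRigidityPricedFloorsIdent

end
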